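import Summits.QuantumFields.YangMills.Theorems.FluctuationComparisonRegPrIntLS2BetaCurlBudgetOfChartTower
import Summits.QuantumFields.YangMills.Theorems.FluctuationComparisonRegPrIntLS2BetaBlockPairReadCover
import HarnessLib

/-!
# S2β · W-ρκ (k1) «THE ρP COLUMN», FILE 1 of 2 — THE READ SIDE: `ρP t B :=` the Pi-sup of the RAW left-relative GROUP-currency plaquette size over the c₁ read cell
# of thickness `2L + 1` at internal level `K − (J+(t+1))`; ✓p835991 `hκrel_of_textLetters`'s region letter `hρT` HOLDS at this `ρP` (the block-pair BOX of every
# `READ′_t(B)` bond lies in that read cell — coarse → fine on the torus + px13's ✓`read'_transport_of_rel_le`)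

Cell `ym3-torus` (YM ladder rung R3 = continuum `SU(2)` Yang–Mills on the three-torus at fixed lattice data — a RUNG: NOT d = 4, NOT infinite volume, NOT a mass gap,
NOT Clay).  Width seat «width 10» `ym3-torus-px10` (gen 26); crux `stmt-QuantumFields-20520`, LINE g18-1 S2β; ARCHITECT RULING «ρκ-CURL» debt (k1) (px10), named by
px21 g25 2026-08-31T22:51:29Z as the `hP` letter of ✓∕⧗`hρκ_of_columns` (px16 g24 FILE δ §3).  `--kind proof --supports stmt-QuantumFields-20520 --as helper`, count-neutral,
DEFINITION-FREE (0 `def`, 0 `instance`, 0 `notation`, 0 `sorry`, default heartbeats).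

WHAT IS PROVED (sorry-free).
§1 ★`natAbs_rel_le_of_blockOf_close` — COARSE → FINE on the torus: `|rel (blockOf x) (blockOf y)|_κ ≤ 1 ⇒ |rel x y|_κ ≤ 2L − 1` (standing range; the converse companion of
   px10 g25's ✓`natAbs_rel_blockOf_le_one`); ★`natAbs_rel_le_of_boxBlock` (block-pair box form, via px21 ✓`natAbs_rel_of_boxBlock`).
§2 ★★`readCell_of_box` — ✓p835991's BOX (`blockOf q.src` = the block of a transported `READ′_t(B)` bond or one of its two neighbours along that bond) ⟹ the c₁ READ CLAUSE
   of ✓p835692∕✓p835744 at thickness `θr := 2·L + 1` (`∃ z₀, blockIter (K−J) z₀ ∈ {σB.src, σB.tgt} ∧ ∀ κ, |rel (blockIter _ z₀) q.src κ| ≤ 2L+1`) — px13 ✓`read'_transport_of_rel_le`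
   at `D := 2L − 1` + §1 + lit ✓`rel_siteShift` + injectivity of `embIter` (lit ✓`blockIter_embIter`).
§3 ★★★**`hρT_of_readSup`** — ✓`hκrel_of_textLetters`'s `hρT` binder text VERBATIM at
   **`ρP t B := ‖(fun q : Plaq (F.P K) (K − (J+(t+1))) => if ⟨read clause, 2L+1⟩ then dist1 ((P_{Ū^s U₀} q)⁻¹·P_{Ū^s(e^ζU₀)} q) else 0)‖`** (`norm_le_pi_norm` + §2).
FILE 2 (`…RhoPColumnBudget`) proves the `hP` budget for this `ρP` from ✓p836340 `curlBudget_of_chartTower` at `θr := 2L+1`, `Cst := 1`.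

HONEST SCOPE.  Torus index bookkeeping over landed letters; nothing of Bałaban's renormalisation-group analysis is asserted or proved ([Balaban1987RG1] (0.1)–(0.4), (0.11)
pp.251–253); the κ-ratio letter's other inputs, every budget, (ST⁗)∕LOC⁗, h3 are HYPOTHESES or others'; GAP♯∘ (`stub_uniformFibreGapOrbit`, registry 3732b7df UNTOUCHED, 0∕5), S2β, the
five registered stubs, crux 20520, 19936, 19200 and `YM3TorusSU2` are NOT proved; no registered stub is closed; rung R3 — NOT d = 4, NOT infinite volume, NOT a mass gap, NOT Clay;
the Yang–Mills mass gap is NOT proved.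
-/

set_option autoImplicit false

open Finset

namespace Summit.QuantumFields.YangMills.Theorems.FluctuationComparisonRegPrIntLS2BetaRhoPColumnRead

open Literature.MathematicalPhysics.QuantumFieldTheory.Balaban1983to89
open Literature.MathematicalPhysics.QuantumFieldTheory.Balaban1983to89.T3ContinuumYM3Torus
open Literature.MathematicalPhysics.QuantumFieldTheory.Balaban1983to89.T3LevelShift
open Literature.MathematicalPhysics.QuantumFieldTheory.Balaban1983to89.B14.Eq22Determines (blockIter)
open Literature.MathematicalPhysics.QuantumFieldTheory.Balaban1983to89.B10Eq27TorusAxialLog (rel rel_apply)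
open Literature.MathematicalPhysics.QuantumFieldTheory.Balaban1983to89.B15DeterminingSets (embIter)
open Literature.MathematicalPhysics.QuantumFieldTheory.Balaban1983to89.B15Eq177GaugeInvariance (blockIter_embIter)
open Summit.QuantumFields.YangMills.Theorems.StrongCouplingShape (natAbs_valMinAbs_intCast_le)
open Literature.MathematicalPhysics.QuantumFieldTheory.Balaban1983to89.T4Continuum
open Literature.MathematicalPhysics.QuantumFieldTheory.Balaban1983to89.T3UnitLawDensityEML (ℰp)
open Literature.MathematicalPhysics.QuantumFieldTheory.Balaban1983to89.T4HaarSU2ExpChart (expPoint)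
open Literature.MathematicalPhysics.QuantumFieldTheory.Balaban1983to89.BlockAveraging (blockAvg)
open Summit.QuantumFields.YangMills.Theorems.FluctuationComparisonRegPrIntLS2BetaBlockPairReadCover (natAbs_rel_of_boxBlock)
open Summit.QuantumFields.YangMills.Theorems.FluctuationComparisonRegPrIntLS2BetaTorusReadTransport (read'_transport_of_rel_le)
open Summit.QuantumFields.YangMills.Theorems.GlobalSlackKernelLeg (rel_siteShift)

/-! ## §1 Coarse-to-fine on the torus: sites of adjacent blocks are at most `2L − 1` apart -/

section Torus

variable {P : Params} {j : ℕ}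

/-- ★ **COARSE → FINE**: if the blocks of `x` and `y` are at most one coarse site apart in coordinate `κ` (least-absolute-value representative),
then `|rel x y|_κ ≤ 2L − 1` (standing range `j + 1 ≤ m + K`: `x = L·⌊x∕L⌋ + r` with `0 ≤ r < L`, and a wrap of the coarse difference is a whole
number of fine periods).  The converse companion of ✓`natAbs_rel_blockOf_le_one`. [cite: Balaban1987RG1, (0.1) p.251-252] -/
theorem natAbs_rel_le_of_blockOf_close (hj : j + 1 ≤ P.m + P.K) (x y : Site P j) (κ : Fin P.d)
    (hδ : (rel (blockOf x) (blockOf y) κ).natAbs ≤ 1) : (rel x y κ).natAbs ≤ 2 * P.L - 1 := by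
  have hN : P.sitesPerDir j = P.sitesPerDir (j + 1) * P.L := P.sitesPerDir_eq_mul_succ hj
  have hL1 : 1 ≤ P.L := P.L_pos
  -- the coarse relation as integers: `⌊y∕L⌋ = ⌊x∕L⌋ + δ + N′·q`
  set δ : ℤ := rel (blockOf x) (blockOf y) κ with hδdef
  have hc : (((((y κ).val / P.L : ℕ) : ℤ)) : ZMod (P.sitesPerDir (j + 1))) =
      (((((x κ).val / P.L : ℕ) : ℤ) + δ : ℤ) : ZMod (P.sitesPerDir (j + 1))) := by
    have e1 : ((blockOf y) κ : ZMod (P.sitesPerDir (j + 1))) = (blockOf x) κ + ((δ : ℤ) : ZMod (P.sitesPerDir (j + 1))) := by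
      rw [hδdef, rel_apply, ZMod.coe_valMinAbs]; ring
    have e2 : ((blockOf y) κ : ZMod (P.sitesPerDir (j + 1))) = ((((y κ).val / P.L : ℕ) : ℤ) : ZMod (P.sitesPerDir (j + 1))) := by
      rw [Int.cast_natCast, ← Site.val_blockOf hj y κ, ZMod.natCast_zmod_val]
    have e3 : ((blockOf x) κ : ZMod (P.sitesPerDir (j + 1))) = ((((x κ).val / P.L : ℕ) : ℤ) : ZMod (P.sitesPerDir (j + 1))) := by
      rw [Int.cast_natCast, ← Site.val_blockOf hj x κ, ZMod.natCast_zmod_val]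
    rw [← e2, e1, e3]; push_cast; ring
  rw [ZMod.intCast_eq_intCast_iff] at hc
  obtain ⟨q, hq⟩ : ∃ q : ℤ, (((y κ).val / P.L : ℕ) : ℤ) = (((x κ).val / P.L : ℕ) : ℤ) + δ + (P.sitesPerDir (j + 1) : ℤ) * q := by
    obtain ⟨k, hk⟩ := Int.modEq_iff_dvd.mp hc
    exact ⟨-k, by rw [mul_neg]; linarith⟩
  -- the fine labels: `v = L·⌊v∕L⌋ + (v mod L)`
  have hx : ((x κ).val : ℤ) = (P.L : ℤ) * (((x κ).val / P.L : ℕ) : ℤ) + (((x κ).val % P.L : ℕ) : ℤ) := by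
    exact_mod_cast (Nat.div_add_mod ((x κ).val) P.L).symm
  have hy : ((y κ).val : ℤ) = (P.L : ℤ) * (((y κ).val / P.L : ℕ) : ℤ) + (((y κ).val % P.L : ℕ) : ℤ) := by
    exact_mod_cast (Nat.div_add_mod ((y κ).val) P.L).symm
  have hrx : (((x κ).val % P.L : ℕ) : ℤ) < P.L := by exact_mod_cast Nat.mod_lt _ P.L_pos
  have hry : (((y κ).val % P.L : ℕ) : ℤ) < P.L := by exact_mod_cast Nat.mod_lt _ P.L_pos
  have hrx0 : (0 : ℤ) ≤ (((x κ).val % P.L : ℕ) : ℤ) := by positivity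
  have hry0 : (0 : ℤ) ≤ (((y κ).val % P.L : ℕ) : ℤ) := by positivity
  -- the fine difference is the class of `D := L·δ + (r_y − r_x)`
  set D : ℤ := (P.L : ℤ) * δ + ((((y κ).val % P.L : ℕ) : ℤ) - (((x κ).val % P.L : ℕ) : ℤ)) with hD
  have hdiff : (y κ : ZMod (P.sitesPerDir j)) - x κ = ((D : ℤ) : ZMod (P.sitesPerDir j)) := by
    have ey : (y κ : ZMod (P.sitesPerDir j)) = ((((y κ).val : ℤ)) : ZMod (P.sitesPerDir j)) := by
      rw [Int.cast_natCast, ZMod.natCast_zmod_val]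
    have ex : (x κ : ZMod (P.sitesPerDir j)) = ((((x κ).val : ℤ)) : ZMod (P.sitesPerDir j)) := by
      rw [Int.cast_natCast, ZMod.natCast_zmod_val]
    have hNz' : (P.sitesPerDir j : ℤ) = (P.sitesPerDir (j + 1) : ℤ) * (P.L : ℤ) := by exact_mod_cast hN
    have key : ((y κ).val : ℤ) - ((x κ).val : ℤ) = D + (P.sitesPerDir j : ℤ) * q := by
      rw [hy, hx, hq, hD, hNz']; ring
    rw [ey, ex, ← Int.cast_sub, key]
    push_cast
    rw [ZMod.natCast_self, zero_mul, add_zero]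
  -- `|valMinAbs| ≤ |D| ≤ L + (L − 1)`
  have hδ1 : δ.natAbs ≤ 1 := hδ
  have hD' : D.natAbs ≤ 2 * P.L - 1 := by
    have hδabs : |δ| ≤ 1 := by rw [Int.abs_eq_natAbs]; exact_mod_cast hδ1
    obtain ⟨hδa, hδb⟩ := abs_le.mp hδabs
    have hL0 : (0 : ℤ) ≤ (P.L : ℤ) := by positivity
    have h1 : D ≤ (P.L : ℤ) * 1 + ((P.L : ℤ) - 1) := by
      rw [hD]; nlinarith
    have h2 : -((P.L : ℤ) * 1 + ((P.L : ℤ) - 1)) ≤ D := by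
      rw [hD]; nlinarith
    have h3 : (D.natAbs : ℤ) ≤ 2 * (P.L : ℤ) - 1 := by
      rw [Int.natCast_natAbs]; exact abs_le.mpr ⟨by linarith, by linarith⟩
    have h4 : ((2 * P.L - 1 : ℕ) : ℤ) = 2 * (P.L : ℤ) - 1 := by omega
    exact_mod_cast (h4 ▸ h3 : (D.natAbs : ℤ) ≤ ((2 * P.L - 1 : ℕ) : ℤ))
  rw [rel_apply, hdiff]
  exact (natAbs_valMinAbs_intCast_le _).trans hD'

/-- ★ Sites whose blocks lie in one block-pair box (`blockOf y ∈ {blockOf x − e_μ, blockOf x, blockOf x + e_μ}`) are at most `2L − 1` apart in every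
coordinate. [cite: Balaban1987RG1, (0.1)-(0.4) p.251-253] -/
theorem natAbs_rel_le_of_boxBlock (hj : j + 1 ≤ P.m + P.K) (x y : Site P j) (μ : Fin P.d)
    (h : blockOf y = (blockOf x).unshift μ ∨ blockOf y = blockOf x ∨ blockOf y = (blockOf x).shift μ) (κ : Fin P.d) :
    (rel x y κ).natAbs ≤ 2 * P.L - 1 :=
  natAbs_rel_le_of_blockOf_close hj x y κ (natAbs_rel_of_boxBlock (blockOf x) (blockOf y) μ h κ)

end Torus

/-! ## §2 The block-pair box lies in the c₁ read cell of thickness `2L + 1` -/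

section Box

variable (F : T3Family)

/-- ★★ **THE BOX IS READ**: if `blockOf q.src` is the block of the transported `READ′_t(B)` bond `σℓ′` or one of its two neighbours along `ℓ′.dir`, then `q.src` satisfies the c₁ read
clause of `B` at thickness `2·L + 1` (px13 ✓`read'_transport_of_rel_le` at `D := 2L − 1`, §1). [cite: Balaban1987RG1, (0.1)-(0.4) pp.251-253] -/
theorem readCell_of_box {J K t : ℕ} (ht : t < K - J) (B : PBond (F.P J) 0) (q : Plaq (F.P K) (K - (J + (t + 1))))
    (hbox : (∃ ℓ' : PBond (F.P (J + (t + 1))) 0, (∃ z : Site (F.P (J + (t + 1))) 0,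
                (B14.Eq22Determines.blockIter (t + 1) z = (bondShift (F.sitesPerDir_eq (m := F.m) (K := J) (j := 0) (m' := F.m) (K' := J + (t + 1)) (j' := t + 1) (by omega)) B).src ∨ B14.Eq22Determines.blockIter (t + 1) z = (bondShift (F.sitesPerDir_eq (m := F.m) (K := J) (j := 0) (m' := F.m) (K' := J + (t + 1)) (j' := t + 1) (by omega)) B).tgt) ∧
                ∀ ν, (B10Eq27TorusAxialLog.rel z ℓ'.src ν).natAbs ≤ 2) ∧
        (blockOf q.src = (blockOf (bondShift (F.sitesPerDir_eq (m := F.m) (K := J + (t + 1)) (j := 0) (m' := F.m) (K' := K) (j' := (K - (J + (t + 1)))) (by omega)) ℓ').src).unshift (bondShift (F.sitesPerDir_eq (m := F.m) (K := J + (t + 1)) (j := 0) (m' := F.m) (K' := K) (j' := (K - (J + (t + 1)))) (by omega)) ℓ').dir ∨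
          blockOf q.src = blockOf (bondShift (F.sitesPerDir_eq (m := F.m) (K := J + (t + 1)) (j := 0) (m' := F.m) (K' := K) (j' := (K - (J + (t + 1)))) (by omega)) ℓ').src ∨
          blockOf q.src = (blockOf (bondShift (F.sitesPerDir_eq (m := F.m) (K := J + (t + 1)) (j := 0) (m' := F.m) (K' := K) (j' := (K - (J + (t + 1)))) (by omega)) ℓ').src).shift (bondShift (F.sitesPerDir_eq (m := F.m) (K := J + (t + 1)) (j := 0) (m' := F.m) (K' := K) (j' := (K - (J + (t + 1)))) (by omega)) ℓ').dir))) :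
    ∃ z₀ : Site (F.P K) 0, (blockIter (K - J) z₀ = (bondShift (F.sitesPerDir_eq (m := F.m) (K := J) (j := 0) (m' := F.m) (K' := K) (j' := K - J) (by omega)) B).src ∨
            blockIter (K - J) z₀ = (bondShift (F.sitesPerDir_eq (m := F.m) (K := J) (j := 0) (m' := F.m) (K' := K) (j' := K - J) (by omega)) B).tgt) ∧
            ∀ κ, (rel (blockIter (K - (J + (t + 1))) z₀) q.src κ).natAbs ≤ 2 * F.L + 1 := by
  classical
  obtain ⟨ℓ', hread, hbox'⟩ := hbox
  have hσ : (F.P (J + (t + 1))).sitesPerDir 0 = (F.P K).sitesPerDir (K - (J + (t + 1))) :=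
    F.sitesPerDir_eq (m := F.m) (K := J + (t + 1)) (j := 0) (m' := F.m) (K' := K) (j' := (K - (J + (t + 1)))) (by omega)
  -- the source read back at the member `F.P (J+t+1)`
  set Y : Site (F.P (J + (t + 1))) 0 := (siteShift hσ).symm q.src with hY
  have hYq : siteShift hσ Y = q.src := (siteShift hσ).apply_symm_apply q.src
  have hj : (K - (J + (t + 1))) + 1 ≤ (F.P K).m + (F.P K).K := by show (K - (J + (t + 1))) + 1 ≤ F.m + K; omega
  -- the fine bound `|rel ℓ′.src Y| ≤ 2L − 1` (coarse → fine, transported)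
  have hD : ∀ κ, (rel ℓ'.src Y κ).natAbs ≤ 2 * F.L - 1 := by
    intro κ
    have h1 := natAbs_rel_le_of_boxBlock hj ((bondShift (F.sitesPerDir_eq (m := F.m) (K := J + (t + 1)) (j := 0) (m' := F.m) (K' := K) (j' := (K - (J + (t + 1)))) (by omega)) ℓ')).src q.src ((bondShift (F.sitesPerDir_eq (m := F.m) (K := J + (t + 1)) (j := 0) (m' := F.m) (K' := K) (j' := (K - (J + (t + 1)))) (by omega)) ℓ')).dir hbox' κ
    have e : rel ℓ'.src Y = rel (siteShift hσ ℓ'.src) (siteShift hσ Y) := (rel_siteShift hσ ℓ'.src Y).symm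
    rw [e, hYq]
    exact h1
  have hmem := read'_transport_of_rel_le (F := F) (J := J) (t := t) (n := (K - (J + (t + 1)))) (m := K - J) (K := K) (by omega) (by omega) B ℓ' hread Y hD
  rw [hYq] at hmem
  obtain ⟨Y', hY', hYY'⟩ := Finset.mem_image.1 hmem
  have hs : (K - (J + (t + 1))) ≤ (F.P K).m + (F.P K).K := by show (K - (J + (t + 1))) ≤ F.m + K; omega
  have hinj : Y' = q.src :=
    calc Y' = blockIter (K - (J + (t + 1))) (embIter (K - (J + (t + 1))) Y') := (blockIter_embIter (P := F.P K) (K - (J + (t + 1))) hs Y').symm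
      _ = blockIter (K - (J + (t + 1))) (embIter (K - (J + (t + 1))) q.src) := by rw [hYY']; rfl
      _ = q.src := blockIter_embIter (P := F.P K) (K - (J + (t + 1))) hs q.src
  obtain ⟨z₀, hz₀, hκ⟩ := (Finset.mem_filter.1 hY').2
  refine ⟨z₀, ?_, fun κ => ?_⟩
  · rcases Finset.mem_insert.1 hz₀ with h | h
    · exact Or.inl h
    · exact Or.inr (Finset.mem_singleton.1 h)
  · have := hκ κ
    rw [hinj] at this
    have hL : 1 ≤ F.L := le_of_lt F.hL.2
    omega

end Box

/-! ## §3 The `hρT` letter at the read-sup -/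

section RhoT

variable (F : T3Family)

/-- ★★★ **✓`hκrel_of_textLetters`'s `hρT` HOLDS AT THE c₁ READ-SUP** `ρP t B := ‖𝟙[read cell of B, thickness 2L+1]·dist1((P_{Ū^sU₀}·)⁻¹·P_{Ū^s(e^ζU₀)}·)‖` (the Pi-sup dominates
its values; the box is read by §2). [cite: Balaban1987RG1, (0.1)-(0.4), (0.11) pp.251-253] -/
theorem hρT_of_readSup {J K : ℕ} (U₀ : GaugeField (F.P K) 0 (Matrix.specialUnitaryGroup (Fin 2) ℂ)) (ζ : PBond (F.P K) 0 → EuclideanSpace ℝ (Fin 3)) :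
    ∀ (t : ℕ) (ht : t < K - J) (B : PBond (F.P J) 0) (q : Plaq (F.P K) (K - (J + (t + 1)))),
      (∃ ℓ' : PBond (F.P (J + (t + 1))) 0, (∃ z : Site (F.P (J + (t + 1))) 0,
                (B14.Eq22Determines.blockIter (t + 1) z = (bondShift (F.sitesPerDir_eq (m := F.m) (K := J) (j := 0) (m' := F.m) (K' := J + (t + 1)) (j' := t + 1) (by omega)) B).src ∨ B14.Eq22Determines.blockIter (t + 1) z = (bondShift (F.sitesPerDir_eq (m := F.m) (K := J) (j := 0) (m' := F.m) (K' := J + (t + 1)) (j' := t + 1) (by omega)) B).tgt) ∧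
                ∀ ν, (B10Eq27TorusAxialLog.rel z ℓ'.src ν).natAbs ≤ 2) ∧
        (blockOf q.src = (blockOf (bondShift (F.sitesPerDir_eq (m := F.m) (K := J + (t + 1)) (j := 0) (m' := F.m) (K' := K) (j' := (K - (J + (t + 1)))) (by omega)) ℓ').src).unshift (bondShift (F.sitesPerDir_eq (m := F.m) (K := J + (t + 1)) (j := 0) (m' := F.m) (K' := K) (j' := (K - (J + (t + 1)))) (by omega)) ℓ').dir ∨
          blockOf q.src = blockOf (bondShift (F.sitesPerDir_eq (m := F.m) (K := J + (t + 1)) (j := 0) (m' := F.m) (K' := K) (j' := (K - (J + (t + 1)))) (by omega)) ℓ').src ∨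
          blockOf q.src = (blockOf (bondShift (F.sitesPerDir_eq (m := F.m) (K := J + (t + 1)) (j := 0) (m' := F.m) (K' := K) (j' := (K - (J + (t + 1)))) (by omega)) ℓ').src).shift (bondShift (F.sitesPerDir_eq (m := F.m) (K := J + (t + 1)) (j := 0) (m' := F.m) (K' := K) (j' := (K - (J + (t + 1)))) (by omega)) ℓ').dir)) →
      dist1 ((GaugeField.plaqHol (Averaging.iter (fun k => BlockAveraging.blockAvg (P := F.P K) (j := k) ℰp) (K - (J + (t + 1))) U₀) q)⁻¹ *
          GaugeField.plaqHol (Averaging.iter (fun k => BlockAveraging.blockAvg (P := F.P K) (j := k) ℰp) (K - (J + (t + 1)))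
            (fun ℓ => expPoint (ζ ℓ) * U₀ ℓ : GaugeField (F.P K) 0 (Matrix.specialUnitaryGroup (Fin 2) ℂ))) q) ≤
        ‖(fun q : Plaq (F.P K) (K - (J + (t + 1))) =>
        if ∃ z₀ : Site (F.P K) 0, (blockIter (K - J) z₀ = (bondShift (F.sitesPerDir_eq (m := F.m) (K := J) (j := 0) (m' := F.m) (K' := K) (j' := K - J) (by omega)) B).src ∨
            blockIter (K - J) z₀ = (bondShift (F.sitesPerDir_eq (m := F.m) (K := J) (j := 0) (m' := F.m) (K' := K) (j' := K - J) (by omega)) B).tgt) ∧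
            ∀ κ, (rel (blockIter (K - (J + (t + 1))) z₀) q.src κ).natAbs ≤ 2 * F.L + 1
        then dist1 ((GaugeField.plaqHol (Averaging.iter (fun k => BlockAveraging.blockAvg (P := F.P K) (j := k) ℰp) (K - (J + (t + 1))) U₀) q)⁻¹ *
          GaugeField.plaqHol (Averaging.iter (fun k => BlockAveraging.blockAvg (P := F.P K) (j := k) ℰp) (K - (J + (t + 1)))
            (fun ℓ => expPoint (ζ ℓ) * U₀ ℓ : GaugeField (F.P K) 0 (Matrix.specialUnitaryGroup (Fin 2) ℂ))) q)
        else 0)‖ := by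
  intro t ht B q hbox
  have hz := readCell_of_box F ht B q hbox
  have h := norm_le_pi_norm (fun q : Plaq (F.P K) (K - (J + (t + 1))) =>
        if ∃ z₀ : Site (F.P K) 0, (blockIter (K - J) z₀ = (bondShift (F.sitesPerDir_eq (m := F.m) (K := J) (j := 0) (m' := F.m) (K' := K) (j' := K - J) (by omega)) B).src ∨
            blockIter (K - J) z₀ = (bondShift (F.sitesPerDir_eq (m := F.m) (K := J) (j := 0) (m' := F.m) (K' := K) (j' := K - J) (by omega)) B).tgt) ∧
            ∀ κ, (rel (blockIter (K - (J + (t + 1))) z₀) q.src κ).natAbs ≤ 2 * F.L + 1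
        then dist1 ((GaugeField.plaqHol (Averaging.iter (fun k => BlockAveraging.blockAvg (P := F.P K) (j := k) ℰp) (K - (J + (t + 1))) U₀) q)⁻¹ *
          GaugeField.plaqHol (Averaging.iter (fun k => BlockAveraging.blockAvg (P := F.P K) (j := k) ℰp) (K - (J + (t + 1)))
            (fun ℓ => expPoint (ζ ℓ) * U₀ ℓ : GaugeField (F.P K) 0 (Matrix.specialUnitaryGroup (Fin 2) ℂ))) q)
        else 0) q
  rw [if_pos hz, Real.norm_of_nonneg (GaugeGroup.dist1_nonneg _)] at h
  exact h

end RhoT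

end Summit.QuantumFields.YangMills.Theorems.FluctuationComparisonRegPrIntLS2BetaRhoPColumnRead
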